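import Summits.CriticalPhenomena.PercolationContinuityZ3.Theorems.Transplant.FKConnectivityAllQK5
import Summits.CriticalPhenomena.PercolationContinuityZ3.Theorems.Transplant.FKConnectivityAllQEdgeLocal
import HarnessLib

/-!
# Connectivity correlation inequalities for `φ_{w,q}`, every `q > 0` — single-edge MONOTONICITY of `φ(x ↔ y)` in the edges AT `x, y`
# on every weighted graph with at most five vertices, `0 < q ≤ 1`

Helper file (`--supports stmt-CriticalPhenomena-4575`), FK sub-lane `prim-bschramm-fk-3` (gen 10) of the post-continuity programme;
builds on p205010 (kernel theorem, internal audit signed; external expert review pending).  No definitions, no named facts, no sorries;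
standard axioms.

Grimmett's comparison inequality (3.21) — connection probabilities are non-decreasing in every edge parameter — is proved for `q ≥ 1` only
(FKG); below `q = 1` it is the "EC⁺" form of edge-negative association (fk-2's master identity; fk-1 g6 `edgeConnMono_of_negCorr_at`).  From the
`K₅` certificate (`edgeNegCorrAdjOn_of_card_le_five`, gen 10) we get the ADJACENT slice on five vertices: for `card V ≤ 5`, `0 < q ≤ 1`, every
weight vector `w` and every non-loop pair `f` meeting `x` or `y`, raising the parameter of `f` from `0` to `1` does not lower `φ_{w,q}(x ↔ y)`
(**`openConn_mono_pair_at_endpoint_of_card_le_five`**).  The far-edge case (`f` disjoint from `{x, y}`) on five vertices is exactly the open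
disjoint-pair Rayleigh question for `K₅` (bschramm/FK-BARRIER.md §14.4).
[cite: Grimmett2006, Thm. (3.21) (p. 43); §3.9 eq. (3.94) (p. 63); §5.8 (p. 131)] [cite: Wagner2006, Conj. 5.3 (p. 13)]
-/

noncomputable section

namespace Summit.CriticalPhenomena.PercolationContinuityZ3.Theorems

namespace FK

open MeasureTheory Literature.Probability.LatticeModels Literature.Probability.Percolation
open scoped Classical

variable {V : Type*} [Fintype V]

/-- **`φ(x ↔ y)` is non-decreasing in the parameter of any pair at `x` or `y`, on every weighted graph with at most five vertices,
`0 < q < 1`**: for `card V ≤ 5`, a non-loop pair `f` containing `x` or `y`, and every weight vector `w`,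
`φ_{w[f↦0],q}(x ↔ y) ≤ φ_{w[f↦1],q}(x ↔ y)`. (Adjacent-edge negative correlation on `≤ 5` vertices + the local master identity.)
[cite: Grimmett2006, Thm. (3.21) (p. 43); §3.9 eq. (3.94) (p. 63)] [cite: Wagner2006, Conj. 5.3 (p. 13)] -/
theorem openConn_mono_pair_at_endpoint_of_card_le_five (hV : Fintype.card V ≤ 5) {q : ℝ} (hq0 : 0 < q) (hq1 : q < 1)
    (w : Sym2 V → unitInterval) (x y : V) (f : Sym2 V) (hf : ¬ f.IsDiag) (hfx : x ∈ f ∨ y ∈ f) :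
    (rcMeasureW (Function.update w f 0) q ∅).real (openConn x y) ≤
      (rcMeasureW (Function.update w f 1) q ∅).real (openConn x y) := by
  set c : unitInterval := ⟨1 / 2, by norm_num, by norm_num⟩ with hc
  refine edgeConnMono_of_negCorr_at hq0 hq1 w f x y c (by rw [hc]; norm_num) (by rw [hc]; norm_num) fun hxy hfe => ?_
  have he : ¬ (s(x, y) : Sym2 V).IsDiag := by rw [Sym2.mk_isDiag_iff]; exact hxy
  have hshare : ∃ v : V, v ∈ s(x, y) ∧ v ∈ f := by
    rcases hfx with h | h
    · exact ⟨x, Sym2.mem_mk_left x y, h⟩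
    · exact ⟨y, Sym2.mem_mk_right x y, h⟩
  exact edgeNegCorrAdjOn_of_card_le_five hV hq0 hq1.le _ s(x, y) f he hf hfe hshare

end FK

end Summit.CriticalPhenomena.PercolationContinuityZ3.Theorems

end
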